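import Summits.CriticalPhenomena.CardyFormulaZ2.Theorems.CardyFlipRussoVoronoiHubFromSmirnovStubMeckeRussoPrelims
import Literature.Analysis.FunctionSpaces.PoissonPointProcessUniqueness
import Literature.Analysis.FunctionSpaces.PoissonPointProcessExistence

/-!
# The union of the two colour classes is a Poisson process of doubled intensity
# (helper of crux `VoronoiHubFromSmirnov`, stmt-CriticalPhenomena-6433, line `moebius-exact-delaunay-dilation-ward`)

For the two-colour law `lawBW μ = poissonLaw μ ⊗ poissonLaw μ` (independent black and white nuclei
of the same locally finite atomless intensity `μ`), the law of ALL nuclei `c.1 ∪ c.2` is the Poisson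
law of intensity `2 μ`: Kingman's Superposition Theorem (`IsPoissonPointProcess.superposition_holds`,
PROVED in tree) and Rényi uniqueness (`unique_holds`).  This is the process `τ = ω_o ∪ ω_c` of
Benjamini–Schramm 1998 §2 on which defects are defined (the coloured configuration is `τ` with an
independent fair colouring — the marking theorem, not here).

References: J. F. C. Kingman, *Poisson Processes* (1993), §2.2 Superposition Theorem; I. Benjamini,
O. Schramm, Comm. Math. Phys. 197 (1998), §2.  No new definitions.
-/

noncomputable section

namespace Summit.CriticalPhenomena.CardyFormulaZ2.Cruxes.VoronoiHubFromSmirnov.MoebiusExactDelaunayDilationWard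

open scoped ENNReal
open MeasureTheory Literature.Analysis.FunctionSpaces

/-- `poissonLaw` of a locally finite atomless intensity on `ℂ` IS a Poisson law of that intensity
(Kingman existence `existsUnique_isPoissonPointProcess_holds` + `Classical.epsilon_spec`). -/
theorem isPoissonPointProcess_poissonLaw_of_atomless (μ : Measure ℂ) [IsLocallyFiniteMeasure μ]
    (hμ : ∀ x : ℂ, μ {x} = 0) : IsPoissonPointProcess μ (poissonLaw μ) :=
  poissonLaw_spec μ (existsUnique_isPoissonPointProcess_holds (E := ℂ) μ hμ).exists

/-- **The union of the two colour classes of `lawBW μ` is Poisson of intensity `2 μ`**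
(registered helper of the crux; Kingman's Superposition Theorem + Rényi uniqueness). -/
theorem lawBW_map_union : ∀ (μ : MeasureTheory.Measure ℂ) [MeasureTheory.IsLocallyFiniteMeasure μ], (∀ x : ℂ, μ {x} = 0) → (lawBW μ).map (fun c : Literature.Analysis.FunctionSpaces.PointConfig ℂ × Literature.Analysis.FunctionSpaces.PointConfig ℂ => c.1 ∪ c.2) = poissonLaw ((2 : ENNReal) • μ) := by
  intro μ _ hμ
  have hP : IsPoissonPointProcess μ (poissonLaw μ) := isPoissonPointProcess_poissonLaw_of_atomless μ hμ
  have hsup := IsPoissonPointProcess.superposition_holds hP hP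
  rw [← two_smul ℝ≥0∞ μ] at hsup
  haveI : IsLocallyFiniteMeasure ((2 : ℝ≥0∞) • μ) := by
    refine ⟨fun x => ?_⟩
    obtain ⟨s, hs, hfin⟩ := (inferInstance : IsLocallyFiniteMeasure μ).finiteAtNhds x
    refine ⟨s, hs, ?_⟩
    rw [Measure.smul_apply, smul_eq_mul]
    exact ENNReal.mul_lt_top (by simp) hfin
  have h2 : IsPoissonPointProcess ((2 : ℝ≥0∞) • μ) (poissonLaw ((2 : ℝ≥0∞) • μ)) :=
    isPoissonPointProcess_poissonLaw_of_atomless _ fun x => by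
      rw [Measure.smul_apply, smul_eq_mul, hμ x, mul_zero]
  exact IsPoissonPointProcess.unique_holds hsup h2

end Summit.CriticalPhenomena.CardyFormulaZ2.Cruxes.VoronoiHubFromSmirnov.MoebiusExactDelaunayDilationWard

end
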